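import Summits.ABC.IUTFork.Repair.RHHeightScalingR4Classes
import Summits.ABC.IUTFork.Repair.RHTowerOrbitHeightLaw
import HarnessLib

/-!
# R-H ROUND 4, census row O-08 — KERNEL FACE of the class-(iii) word «exponent −1 along every isogeny / Kummer-tower orbit; tower
# index DATA-INERT», in the typed class vocabulary (abc-iut-rh2-T-1 `RHHeightScalingR4Classes` §3: `towerRay`, `Tower_NegExponent`) and
# in p532994's profile words (`ExponentAtMost` / `NegExponent` / `DoorAt`), over this seat's orbit law `RHTowerOrbitHeightLaw` (p537683)

PROOF-ONLY file (0 definitions, 0 `Prop` facts, no instance, no notation) of the abc-iut cell (rung LADDER-ABC:A2.RESCUE.H); seat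
abc-iut-rh2-q2-cond (gen 14), KEY `wake/KEY-abc-iut-rh2-q2-cond-R4FACE-TOWER.md` (abc-iut-rh-lead g5 2026-08-27T14:54:40Z under director-abc
g6-D15 (4): «each theorem's STATEMENT is a census KILLED word made kernel-exact (the exponent −1 / the exact cell / the inertness identity) …
cite w-2 / T-1 decls BY NAME where they already state a clause — no duplicates»). Numbers of record: memo `plan/rescue/R-H/ROUND4/R4-6-TOWER-rh2-q2-cond.md`
(kit j280614: 49 899 orbit points, 0 cap violations, step slopes −1.00…−1.09), rh2-tab-1 `R4-6-EXPONENT-TABLE.md` row (iii).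
NOT RESTATED HERE (cited BY NAME, abc-iut-rh2-w-2 `RHHeightScalingR4RayFaces`, in flight at filing): `tower_negExponent : Tower_NegExponent`,
`not_tower_door : ¬ Tower_Door`, `totalPrice_towerRay_le`, `ray_exponentAtMost` — the netting-envelope face of the typed Prop. THIS file adds the
three clauses the table's row (iii) prints that those do not carry:

* §1 TOWER-INDEX INERTNESS (identities over T-1's `towerRay`): the orbit point `n` of ANY multiplier schedule `t` IS the round-3 datum with local
  heights `t_w(n)·m_w` at the SAME places read at ray step `1` (`totalDemand_/totalPrice_/nettingKept_towerRay_eq_heightRay_one`); two schedules with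
  the same local heights give the same ray (`towerRay_congr_heights`: the tower data `(N, c_w, direction, index)` enter ONLY through the products
  `t_w·m_w`); the uniform schedule `t ≡ n` IS the height ray (`towerRay_natCast_eq_heightRay`, by `rfl`); the μ-type `N`-tower `t ≡ N^n` is the
  SUB-RAY `s = N^a` (`nettingKept_muTower_eq_heightRay_pow`, `stepProfile_muTower_eq_heightRay_pow`).
* §2 THE ORBIT HEIGHT LAW IN CELL CURRENCY: the trivial mass at an orbit point is LINEAR in the multipliers, `M(n) = Σ_w t_w(n)·u_w·D_w`
  (`totalDemand_towerRay_eq_sum_mul`; μ-tower: `M(a) = N^a·M(1)`, `totalDemand_muTower_eq_pow_mul`) — the currency height (`log(q)`-type, [IUTchIV]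
  Def. 1.9 reading of the memo's dictionary (T3): `ord_w(q) ↦ N^{c_w}·ord_w(q)`) moves MULTIPLICATIVELY along the orbit. (Print's FALTINGS height moves
  by `≤ ½·log deg φ` — the tree's named fact `WeierstrassCurve.stableFaltingsHeight_le_of_isogeny` (`Literature/NumberTheory/DiophantineGeometry/
  FaltingsHeight.lean`; proved: `…_holds` in `FaltingsHeightIsogenyFiniteProofs`), the memo's (T4); it is NOT the currency height and is neither
  imported nor used here.) Consequence: T-1's growth hypothesis of `Tower_NegExponent`
  («`n·M₁ ≤ M(n)`») is DISCHARGED for every schedule with `t_w(n) ≥ n`, in particular every μ-type tower with `N ≥ 2`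
  (`totalDemand_towerRay_ge_linear`, `totalDemand_muTower_ge_linear`) — so the typed Prop bites on the towers of record non-vacuously.
* §3 EXPONENT −1 IN `ExponentAtMost` WORDS FOR THE FINANCING CLASS (EXP-3) ALONG THE ORBIT (this seat's functional, p537683 §1
  `towerOrbit_credit_le_cap` BY NAME): for height-indexed integer multipliers `t_i(s) ≥ 0` and slice boundaries `J_i(s) ≤ L` the recovered fraction
  `credit(s)/(s·M₁)` has `ExponentAtMost (−1) (Σ_i c_i·C_Π(i)/M₁)` (`towerOrbit_financing_exponentAtMost`), hence `NegExponent` and `¬ DoorAt`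
  — whatever the direction of the tower.
* §4 «−1 EXACTLY»: the financed mass `Σ_i c_i·min(C_σ, R)_i` (p532255's spelling) is `≤ Σ_i c_i·(δ_i + 2G_i + e_i − 1)` at EVERY orbit point
  (`slack_one_bracket`) and `≥ Σ_i c_i·(δ_i + 2G_i)` at every point above onset (p537683 `towerOrbit_financedMass_bracket`): its profile has
  `ExponentAtMost (−1) (B⁺/M₁)` and — the generic real lemma `not_exponentAtMost_of_mul_inv_le` — admits NO exponent `α < −1` once the orbit stays
  above onset and `B⁻ = Σ_i c_i·(δ_i + 2G_i) > 0` (`towerOrbit_financedMass_exponent_exact`).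
* §5 WORKED ORBIT X1 (FREY `p = 7`, `l = 107`) in profile words: along ANY floor schedule `a(s)` of the 2-tower (place height `210·2^{a(s)}`) and any
  slice boundary `J(s) ≤ 53`, the EXP-3 fraction against the base requirement `10 707 060·s` has `ExponentAtMost (−1) (9 414 496 / 10 707 060)`
  (`row_frey7_l107_tower2_exponentAtMost`; p534933 `row_frey7_l107_onSliceCredit_le_envelope` BY NAME).
HONEST FRAMING: integer / elementary real arithmetic about OUR typed cell currency and T-1's claim-tagged rays; «exponent −1», «data-inert»,
«never a door» are words about OUR profiles along the typed orbit, not about [IUTchIII] Cor. 3.12 / [IUTchIV] Thm. 1.10 in print; the isogeny /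
Kummer dictionary is the memo's modelling hypothesis (loci there); nothing here asserts that abc is proved or refuted, or takes a side on any author;
typed ≠ proved; computed ≠ proved. [cite: Mochizuki2012, IUTchIII Rmk. 2.1.1 (ii) p. 62; IUTchIV Def. 1.9 p. 19, Prop. 1.2 p. 10]
[cite: Silverman1994, V Ex. 5.10, 5.15 pp. 452–453] [claim: Mochizuki2012, status: disputed]
-/

namespace Summit.ABC.IUTFork.Repair.RH.TowerOrbit

open Finset Filter Topology
open Summit.ABC.IUTFork.Repair.RH.HeightScaling Summit.ABC.IUTFork.Repair.RH.HeightScalingR4Classes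
open Summit.ABC.IUTFork.Repair.RH.WithinPlaceFinancingHeightLaw

/-! ## §1. Tower-index inertness: identities over T-1's `towerRay` -/

section ClassVocabulary

variable {ι : Type}

/-- **The uniform schedule `t_w(n) = n` IS the round-3 height ray** (definitionally): the D2 ray of record is the tower class's uniform member.
[folklore] -/
theorem towerRay_natCast_eq_heightRay (W : Finset ι) (L : ℕ) (e m₁ δ rin rout : ι → ℤ) (u : ι → ℝ) (tol : ℝ) :
    towerRay (fun n _ => (n : ℤ)) W L e m₁ δ rin rout u tol = heightRay W L e m₁ δ rin rout u tol := rfl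

/-- **DATA-INERT (i): the tower data enter only through the local heights.** Two multiplier schedules / base depths with the same products
`t_w(n)·m_w` at every step give the SAME ray — the tower's `N`, the exponents `c_w`, the direction and the index are invisible to every
functional of the class. [folklore] -/
theorem towerRay_congr_heights {t t' : ℕ → ι → ℤ} {m₁ m₁' : ι → ℤ} (h : ∀ n w, t n w * m₁ w = t' n w * m₁' w)
    (W : Finset ι) (L : ℕ) (e δ rin rout : ι → ℤ) (u : ι → ℝ) (tol : ℝ) :
    towerRay t W L e m₁ δ rin rout u tol = towerRay t' W L e m₁' δ rin rout u tol := by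
  have hf : (fun n w => t n w * m₁ w) = fun n w => t' n w * m₁' w := funext fun n => funext fun w => h n w
  unfold towerRay
  rw [hf]

/-- **DATA-INERT (ii), mass**: the trivial mass at orbit point `n` is the round-3 mass of the datum with depths `t_w(n)·m_w` at ray step `1`.
[folklore] -/
theorem totalDemand_towerRay_eq_heightRay_one (t : ℕ → ι → ℤ) (W : Finset ι) (L : ℕ) (e m₁ δ rin rout : ι → ℤ) (u : ι → ℝ)
    (tol : ℝ) (n : ℕ) :
    totalDemand (towerRay t W L e m₁ δ rin rout u tol) n =
      totalDemand (heightRay W L e (fun w => t n w * m₁ w) δ rin rout u tol) 1 := by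
  unfold totalDemand towerRay heightRay
  simp only [Nat.cast_one, one_mul]

/-- **DATA-INERT (ii), price**: the price ceiling at orbit point `n` is the round-3 price of the datum with depths `t_w(n)·m_w` at step `1`.
[folklore] -/
theorem totalPrice_towerRay_eq_heightRay_one (t : ℕ → ι → ℤ) (W : Finset ι) (L : ℕ) (e m₁ δ rin rout : ι → ℤ) (u : ι → ℝ)
    (tol : ℝ) (n : ℕ) :
    totalPrice (towerRay t W L e m₁ δ rin rout u tol) n =
      totalPrice (heightRay W L e (fun w => t n w * m₁ w) δ rin rout u tol) 1 := by
  unfold totalPrice towerRay heightRay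
  simp only [Nat.cast_one, one_mul]

/-- **DATA-INERT (ii), kept fraction**: the netting-envelope kept fraction at orbit point `n` IS the round-3 kept fraction of the datum with local
heights `t_w(n)·m_w` at the same places (step `1`) — an orbit point is a point of the capped orthant, nothing else. [folklore] -/
theorem nettingKept_towerRay_eq_heightRay_one (t : ℕ → ι → ℤ) (W : Finset ι) (L : ℕ) (e m₁ δ rin rout : ι → ℤ) (u : ι → ℝ)
    (tol : ℝ) (n : ℕ) :
    nettingKept (towerRay t W L e m₁ δ rin rout u tol) n =
      nettingKept (heightRay W L e (fun w => t n w * m₁ w) δ rin rout u tol) 1 := by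
  unfold nettingKept
  rw [totalDemand_towerRay_eq_heightRay_one, totalPrice_towerRay_eq_heightRay_one]

/-- **SUB-RAY, mass**: floor `a` of the μ-type `N`-tower (`t_w(a) = N^a` at every place) has the height ray's mass at `s = N^a`. [folklore] -/
theorem totalDemand_muTower_eq_heightRay_pow (N : ℕ) (W : Finset ι) (L : ℕ) (e m₁ δ rin rout : ι → ℤ) (u : ι → ℝ) (tol : ℝ)
    (a : ℕ) :
    totalDemand (towerRay (fun n _ => (N : ℤ) ^ n) W L e m₁ δ rin rout u tol) a =
      totalDemand (heightRay W L e m₁ δ rin rout u tol) (N ^ a) := by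
  unfold totalDemand towerRay heightRay
  simp only [Nat.cast_pow]

/-- **SUB-RAY, price**: floor `a` of the μ-type `N`-tower has the height ray's price ceiling at `s = N^a`. [folklore] -/
theorem totalPrice_muTower_eq_heightRay_pow (N : ℕ) (W : Finset ι) (L : ℕ) (e m₁ δ rin rout : ι → ℤ) (u : ι → ℝ) (tol : ℝ)
    (a : ℕ) :
    totalPrice (towerRay (fun n _ => (N : ℤ) ^ n) W L e m₁ δ rin rout u tol) a =
      totalPrice (heightRay W L e m₁ δ rin rout u tol) (N ^ a) := by
  unfold totalPrice towerRay heightRay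
  simp only [Nat.cast_pow]

/-- **THE μ-TYPE TOWER IS A SUB-RAY** (census O-08 «uniform tower = sub-ray `s = N^a`», kernel-exact): the kept fraction at floor `a` of the
`N`-tower EQUALS the height ray's kept fraction at step `N^a`. [folklore] -/
theorem nettingKept_muTower_eq_heightRay_pow (N : ℕ) (W : Finset ι) (L : ℕ) (e m₁ δ rin rout : ι → ℤ) (u : ι → ℝ) (tol : ℝ)
    (a : ℕ) :
    nettingKept (towerRay (fun n _ => (N : ℤ) ^ n) W L e m₁ δ rin rout u tol) a =
      nettingKept (heightRay W L e m₁ δ rin rout u tol) (N ^ a) := by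
  unfold nettingKept
  rw [totalDemand_muTower_eq_heightRay_pow, totalPrice_muTower_eq_heightRay_pow]

/-- The same in p532994's profile words (`stepProfile`, the real ray parameter sampled at the integers): the tower's profile at `a` is the ray's
profile at `N^a`. [folklore] -/
theorem stepProfile_muTower_eq_heightRay_pow (N : ℕ) (W : Finset ι) (L : ℕ) (e m₁ δ rin rout : ι → ℤ) (u : ι → ℝ) (tol : ℝ)
    (a : ℕ) :
    stepProfile (nettingKept (towerRay (fun n _ => (N : ℤ) ^ n) W L e m₁ δ rin rout u tol)) (a : ℝ) =
      stepProfile (nettingKept (heightRay W L e m₁ δ rin rout u tol)) ((N ^ a : ℕ) : ℝ) := by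
  unfold stepProfile
  rw [Nat.floor_natCast, Nat.floor_natCast, nettingKept_muTower_eq_heightRay_pow]

/-! ## §2. The orbit height law in cell currency: the mass is linear in the multipliers -/

/-- The height ray's mass at step `1`: `M(1) = Σ_w u_w·D_w`, `D_w = Σ_{j ≤ L} demand(m_w) j`. [folklore] -/
theorem totalDemand_heightRay_one (W : Finset ι) (L : ℕ) (e m₁ δ rin rout : ι → ℤ) (u : ι → ℝ) (tol : ℝ) :
    totalDemand (heightRay W L e m₁ δ rin rout u tol) 1 =
      ∑ w ∈ W, u w * ((∑ k ∈ range L, demand (m₁ w) (1 + (k : ℤ)) : ℤ) : ℝ) := by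
  unfold totalDemand heightRay
  simp only [Nat.cast_one, one_mul]

/-- **THE ORBIT HEIGHT LAW (cell currency).** At orbit point `n` the trivial mass is `M(n) = Σ_w t_w(n)·(u_w·D_w)`: LINEAR in the per-place
multipliers (`demand_dilate`: every cell's demand `(j²−1)·m` is linear in the depth). In the memo's dictionary (T3) `t_w = N^{c_w}`: the currency
(`log(q)`-type) height of the isogenous curve is the multiplier-weighted sum of the base curve's local heights — it moves MULTIPLICATIVELY along the
orbit (contrast print's Faltings height, the tree's `WeierstrassCurve.stableFaltingsHeight_le_of_isogeny`: additive `½·log deg φ`; not used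
here). [folklore] -/
theorem totalDemand_towerRay_eq_sum_mul (t : ℕ → ι → ℤ) (W : Finset ι) (L : ℕ) (e m₁ δ rin rout : ι → ℤ) (u : ι → ℝ) (tol : ℝ)
    (n : ℕ) :
    totalDemand (towerRay t W L e m₁ δ rin rout u tol) n =
      ∑ w ∈ W, (t n w : ℝ) * (u w * ((∑ k ∈ range L, demand (m₁ w) (1 + (k : ℤ)) : ℤ) : ℝ)) := by
  unfold totalDemand towerRay
  refine sum_congr rfl fun w _ => ?_
  have h : ∑ k ∈ range L, demand (t n w * m₁ w) (1 + (k : ℤ)) = t n w * ∑ k ∈ range L, demand (m₁ w) (1 + (k : ℤ)) := by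
    rw [mul_sum]
    exact sum_congr rfl fun k _ => demand_dilate _ _ _
  dsimp only
  rw [h]
  push_cast
  ring

/-- **μ-tower: `M(a) = N^a·M(1)`** — along the uniform `N`-tower the currency height is multiplied by `N` at every floor. [folklore] -/
theorem totalDemand_muTower_eq_pow_mul (N : ℕ) (W : Finset ι) (L : ℕ) (e m₁ δ rin rout : ι → ℤ) (u : ι → ℝ) (tol : ℝ) (a : ℕ) :
    totalDemand (towerRay (fun n _ => (N : ℤ) ^ n) W L e m₁ δ rin rout u tol) a =
      (N : ℝ) ^ a * totalDemand (heightRay W L e m₁ δ rin rout u tol) 1 := by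
  rw [totalDemand_towerRay_eq_sum_mul, totalDemand_heightRay_one, mul_sum]
  refine sum_congr rfl fun w _ => ?_
  push_cast
  ring

/-- `N ≥ 2 ⇒ n ≤ N^n` (integers). [folklore] -/
theorem natCast_le_pow_of_two_le {N : ℕ} (hN : 2 ≤ N) (n : ℕ) : (n : ℤ) ≤ (N : ℤ) ^ n := by
  have h : n < N ^ n := Nat.lt_pow_self (by omega)
  exact_mod_cast h.le

/-- **T-1's growth hypothesis DISCHARGED**: if every multiplier dominates the index (`n ≤ t_w(n)`), depths `m_w ≥ 0` and weights `u_w ≥ 0`, then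
`n·M(1) ≤ M(n)` along `towerRay t …` — the hypothesis `∀ n ≥ 1, n·M₁ ≤ totalDemand (towerRay …) n` of `Tower_NegExponent` (abc-iut-rh2-T-1
`RHHeightScalingR4Classes` §3; proved AS TYPED by abc-iut-rh2-w-2 `tower_negExponent`) with `M₁ := M(1)` of the base datum. [folklore] -/
theorem totalDemand_towerRay_ge_linear {t : ℕ → ι → ℤ} (ht : ∀ (n : ℕ) (w : ι), (n : ℤ) ≤ t n w) {W : Finset ι} {m₁ : ι → ℤ} {u : ι → ℝ}
    (hm : ∀ w ∈ W, 0 ≤ m₁ w) (hu : ∀ w ∈ W, 0 ≤ u w) (L : ℕ) (e δ rin rout : ι → ℤ) (tol : ℝ) (n : ℕ) :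
    (n : ℝ) * totalDemand (heightRay W L e m₁ δ rin rout u tol) 1 ≤ totalDemand (towerRay t W L e m₁ δ rin rout u tol) n := by
  rw [totalDemand_towerRay_eq_sum_mul, totalDemand_heightRay_one, mul_sum]
  refine sum_le_sum fun w hw => ?_
  have hD : (0 : ℤ) ≤ ∑ k ∈ range L, demand (m₁ w) (1 + (k : ℤ)) :=
    sum_nonneg fun k _ => demand_nonneg (hm w hw) (by omega)
  have hD' : (0 : ℝ) ≤ u w * ((∑ k ∈ range L, demand (m₁ w) (1 + (k : ℤ)) : ℤ) : ℝ) :=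
    mul_nonneg (hu w hw) (by exact_mod_cast hD)
  have htn : (n : ℝ) ≤ (t n w : ℝ) := by exact_mod_cast ht n w
  exact mul_le_mul_of_nonneg_right htn hD'

/-- **Every μ-type tower (`N ≥ 2`) has at-least-linear currency height in the floor index**: `a·M(1) ≤ M(a) = N^a·M(1)` — so the typed
`Tower_NegExponent` bites on the towers of record with `M₁ = M(1) > 0` (non-vacuously). [folklore] -/
theorem totalDemand_muTower_ge_linear {N : ℕ} (hN : 2 ≤ N) {W : Finset ι} {m₁ : ι → ℤ} {u : ι → ℝ}
    (hm : ∀ w ∈ W, 0 ≤ m₁ w) (hu : ∀ w ∈ W, 0 ≤ u w) (L : ℕ) (e δ rin rout : ι → ℤ) (tol : ℝ) (a : ℕ) :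
    (a : ℝ) * totalDemand (heightRay W L e m₁ δ rin rout u tol) 1 ≤
      totalDemand (towerRay (fun n _ => (N : ℤ) ^ n) W L e m₁ δ rin rout u tol) a :=
  totalDemand_towerRay_ge_linear (fun n _ => natCast_le_pow_of_two_le hN n) hm hu L e δ rin rout tol a

end ClassVocabulary

/-! ## §3. Exponent −1 in `ExponentAtMost` words for the financing class along the orbit (any direction) -/

variable {k : ℕ}

/-- **EXP-3 ALONG THE ORBIT HAS `ExponentAtMost (−1) (Σ_i c_i·C_Π(i)/M₁)`.** Finitely many places `i : Fin k` (`0 < e_i`, `0 ≤ δ_i`,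
`r_out ≤ r_in`, `m_i ≥ 0`), weights `c_i ≥ 0`, height-indexed INTEGER multipliers `t_i(s) ≥ 0` (a tower read at floor `⌊s⌋`, a mixed μ/étale pattern,
the ray `t_i(s) = ⌊s⌋`, …), slice boundaries `J_i(s) ≤ L`, requirement scale `M₁ > 0`: the recovered fraction `credit(s)/(s·M₁)` of the within-place
financing class is `≤ (Σ_i c_i·C_Π(i)/M₁)·s⁻¹` at every `s ≥ 1` (p537683 `towerOrbit_credit_le_cap` + p532994 `exponentAtMost_neg_one_of_le_const`
BY NAME) — the ray's exponent and the ray's constant, whatever the direction. [folklore] -/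
theorem towerOrbit_financing_exponentAtMost {e δ rin rout m : Fin k → ℤ} (he : ∀ i, 0 < e i) (hδ : ∀ i, 0 ≤ δ i)
    (hio : ∀ i, rout i ≤ rin i) (hm : ∀ i, 0 ≤ m i) {L : ℕ} {c : Fin k → ℝ} (hc : ∀ i, 0 ≤ c i)
    {t : Fin k → ℝ → ℤ} {J : Fin k → ℝ → ℕ} (ht : ∀ i s, 1 ≤ s → 0 ≤ t i s) (hJ : ∀ i s, 1 ≤ s → J i s ≤ L)
    {M₁ : ℝ} (hM : 0 < M₁) :
    ExponentAtMost
      (fun s => (∑ i, c i * ((∑ n ∈ range (J i s), (((1 + (n : ℤ)) * δ i + (1 + (n : ℤ) + 1) * (rin i - rout i) +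
          ((1 + (n : ℤ)) ^ 2 * (t i s * m i) - (1 + (n : ℤ)) * δ i - (1 + (n : ℤ) + 1) * rin i) % e i) -
            ((1 + (n : ℤ)) ^ 2 - 1) * (t i s * m i)) : ℤ) : ℝ)) / (s * M₁))
      (-1)
      ((∑ i, c i * ((∑ n ∈ range L, ((1 + (n : ℤ)) * δ i + (1 + (n : ℤ) + 1) * (rin i - rout i) + (e i - 1)) : ℤ) : ℝ)) / M₁) :=
  exponentAtMost_neg_one_of_le_const hM fun s hs =>
    towerOrbit_credit_le_cap he hδ hio hm (fun i => ht i s hs) hc (fun i => hJ i s hs)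

/-- The weighted cap `Σ_i c_i·C_Π(i)` is non-negative (`δ_i ≥ 0`, `r_out ≤ r_in`, `e_i ≥ 1`, `c_i ≥ 0`). [folklore] -/
theorem towerOrbit_capSum_nonneg {e δ rin rout : Fin k → ℤ} (he : ∀ i, 0 < e i) (hδ : ∀ i, 0 ≤ δ i) (hio : ∀ i, rout i ≤ rin i)
    (L : ℕ) {c : Fin k → ℝ} (hc : ∀ i, 0 ≤ c i) :
    0 ≤ ∑ i, c i * ((∑ n ∈ range L, ((1 + (n : ℤ)) * δ i + (1 + (n : ℤ) + 1) * (rin i - rout i) + (e i - 1)) : ℤ) : ℝ) := by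
  refine sum_nonneg fun i _ => mul_nonneg (hc i) ?_
  have h : (0 : ℤ) ≤ ∑ n ∈ range L, ((1 + (n : ℤ)) * δ i + (1 + (n : ℤ) + 1) * (rin i - rout i) + (e i - 1)) := by
    refine sum_nonneg fun n _ => ?_
    have h1 : 0 ≤ (1 + (n : ℤ)) * δ i := mul_nonneg (by positivity) (hδ i)
    have h2 : 0 ≤ (1 + (n : ℤ) + 1) * (rin i - rout i) := mul_nonneg (by positivity) (sub_nonneg.mpr (hio i))
    have h3 : 0 ≤ e i - 1 := by linarith [he i]
    linarith
  exact_mod_cast h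

/-- **EXP-3 along the orbit has a NEGATIVE EXPONENT** (namely `−1`, constant `Σ_i c_i·C_Π(i)/M₁ ≥ 0`). [folklore] -/
theorem towerOrbit_financing_negExponent {e δ rin rout m : Fin k → ℤ} (he : ∀ i, 0 < e i) (hδ : ∀ i, 0 ≤ δ i)
    (hio : ∀ i, rout i ≤ rin i) (hm : ∀ i, 0 ≤ m i) {L : ℕ} {c : Fin k → ℝ} (hc : ∀ i, 0 ≤ c i)
    {t : Fin k → ℝ → ℤ} {J : Fin k → ℝ → ℕ} (ht : ∀ i s, 1 ≤ s → 0 ≤ t i s) (hJ : ∀ i s, 1 ≤ s → J i s ≤ L)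
    {M₁ : ℝ} (hM : 0 < M₁) :
    NegExponent
      (fun s => (∑ i, c i * ((∑ n ∈ range (J i s), (((1 + (n : ℤ)) * δ i + (1 + (n : ℤ) + 1) * (rin i - rout i) +
          ((1 + (n : ℤ)) ^ 2 * (t i s * m i) - (1 + (n : ℤ)) * δ i - (1 + (n : ℤ) + 1) * rin i) % e i) -
            ((1 + (n : ℤ)) ^ 2 - 1) * (t i s * m i)) : ℤ) : ℝ)) / (s * M₁)) :=
  ⟨-1, _, by norm_num, div_nonneg (towerOrbit_capSum_nonneg he hδ hio L hc) hM.le,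
    towerOrbit_financing_exponentAtMost he hδ hio hm hc ht hJ hM⟩

/-- **EXP-3 along the orbit is NEVER A DOOR** (p532994 `not_doorAt_of_negExponent`): no direction of an isogeny / Kummer tower keeps the
financing fraction above a positive constant. KILLED-BY-CONSISTENCY, kernel-exact. [folklore] -/
theorem towerOrbit_financing_not_doorAt {e δ rin rout m : Fin k → ℤ} (he : ∀ i, 0 < e i) (hδ : ∀ i, 0 ≤ δ i)
    (hio : ∀ i, rout i ≤ rin i) (hm : ∀ i, 0 ≤ m i) {L : ℕ} {c : Fin k → ℝ} (hc : ∀ i, 0 ≤ c i)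
    {t : Fin k → ℝ → ℤ} {J : Fin k → ℝ → ℕ} (ht : ∀ i s, 1 ≤ s → 0 ≤ t i s) (hJ : ∀ i s, 1 ≤ s → J i s ≤ L)
    {M₁ : ℝ} (hM : 0 < M₁) :
    ¬ DoorAt
      (fun s => (∑ i, c i * ((∑ n ∈ range (J i s), (((1 + (n : ℤ)) * δ i + (1 + (n : ℤ) + 1) * (rin i - rout i) +
          ((1 + (n : ℤ)) ^ 2 * (t i s * m i) - (1 + (n : ℤ)) * δ i - (1 + (n : ℤ) + 1) * rin i) % e i) -
            ((1 + (n : ℤ)) ^ 2 - 1) * (t i s * m i)) : ℤ) : ℝ)) / (s * M₁)) :=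
  not_doorAt_of_negExponent (towerOrbit_financing_negExponent he hδ hio hm hc ht hJ hM)

/-! ## §4. «−1 EXACTLY»: the financed mass is pinned between two m′-free constants, so no exponent below −1 -/

/-- **A profile pinned below by `b·s⁻¹` (`b > 0`) from some height `s₀ ≥ 1` on admits NO exponent `α < −1`** (with any constant): `b ≤ C·s^{α+1} → 0`.
The real half of «exponent −1 EXACTLY». [folklore] -/
theorem not_exponentAtMost_of_mul_inv_le {f : ℝ → ℝ} {b s₀ : ℝ} (hb : 0 < b) (hs₀ : 1 ≤ s₀)
    (h : ∀ s : ℝ, s₀ ≤ s → b * s⁻¹ ≤ f s) {α : ℝ} (hα : α < -1) (C : ℝ) : ¬ ExponentAtMost f α C := by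
  intro hf
  have key : ∀ s : ℝ, s₀ ≤ s → b ≤ C * s ^ (α + 1) := by
    intro s hs
    have hs1 : 1 ≤ s := hs₀.trans hs
    have hs0 : 0 < s := by linarith
    have h1 : b * s⁻¹ ≤ C * s ^ α := (h s hs).trans (hf s hs1)
    have h2 : C * s ^ (α + 1) = C * s ^ α * s := by
      rw [Real.rpow_add hs0, Real.rpow_one]; ring
    rw [h2]
    calc b = b * s⁻¹ * s := by field_simp
      _ ≤ C * s ^ α * s := mul_le_mul_of_nonneg_right h1 hs0.le
  have ht : Tendsto (fun s : ℝ => C * s ^ (α + 1)) atTop (𝓝 (C * 0)) := by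
    have h0 := (tendsto_rpow_neg_atTop (show 0 < -(α + 1) by linarith)).const_mul C
    simpa only [neg_neg] using h0
  rw [mul_zero] at ht
  obtain ⟨N, hN⟩ := Filter.eventually_atTop.mp (ht.eventually (gt_mem_nhds hb))
  exact absurd (key (max s₀ N) (le_max_left _ _)) (not_le.mpr (hN _ (le_max_right _ _)))

/-- **The financed mass is under an m′-FREE constant at EVERY orbit point**: `Σ_i c_i·min(C_σ, R)_i(m′_i) ≤ Σ_i c_i·(δ_i + 2G_i + e_i − 1)` for ANY
depths `m′_i` (`min ≤ s_1 ≤ δ + 2G + e − 1`, p532255 `slack_one_bracket` BY NAME; `c_i ≥ 0`, `0 < e_i`). [folklore] -/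
theorem towerOrbit_financedMass_le_const {e δ rin rout : Fin k → ℤ} (he : ∀ i, 0 < e i) {c : Fin k → ℝ} (hc : ∀ i, 0 ≤ c i)
    (L : ℕ) (m' : Fin k → ℤ) :
    ∑ i, c i * ((min ((((1 : ℤ) * δ i + (1 + 1) * (rin i - rout i) + ((1 : ℤ) ^ 2 * m' i - 1 * δ i - (1 + 1) * rin i) % e i) -
            ((1 : ℤ) ^ 2 - 1) * m' i))
          ((((1 : ℤ) * δ i + (1 + 1) * (rin i - rout i) + ((1 : ℤ) ^ 2 * m' i - 1 * δ i - (1 + 1) * rin i) % e i) -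
            ((1 : ℤ) ^ 2 - 1) * m' i) -
            ∑ n ∈ range L, (((1 + (n : ℤ)) * δ i + (1 + (n : ℤ) + 1) * (rin i - rout i) +
              ((1 + (n : ℤ)) ^ 2 * m' i - (1 + (n : ℤ)) * δ i - (1 + (n : ℤ) + 1) * rin i) % e i) -
                ((1 + (n : ℤ)) ^ 2 - 1) * m' i)) : ℤ) : ℝ) ≤
      ∑ i, c i * ((δ i + 2 * (rin i - rout i) + (e i - 1) : ℤ) : ℝ) := by
  refine sum_le_sum fun i _ => mul_le_mul_of_nonneg_left ?_ (hc i)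
  exact_mod_cast (min_le_left _ _).trans (slack_one_bracket (he i) (m' i) (δ i) (rin i) (rout i)).2

/-- **THE FINANCED-MASS PROFILE HAS `ExponentAtMost (−1) (Σ_i c_i·(δ_i + 2G_i + e_i − 1)/M₁)` ALONG EVERY ORBIT** (any real-indexed depths
`m′_i(s)`, requirement scale `M₁ > 0`). [folklore] -/
theorem towerOrbit_financedMass_exponentAtMost {e δ rin rout : Fin k → ℤ} (he : ∀ i, 0 < e i) {c : Fin k → ℝ} (hc : ∀ i, 0 ≤ c i)
    (L : ℕ) (m' : Fin k → ℝ → ℤ) {M₁ : ℝ} (hM : 0 < M₁) :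
    ExponentAtMost
      (fun s => (∑ i, c i * ((min ((((1 : ℤ) * δ i + (1 + 1) * (rin i - rout i) + ((1 : ℤ) ^ 2 * m' i s - 1 * δ i - (1 + 1) * rin i) % e i) -
            ((1 : ℤ) ^ 2 - 1) * m' i s))
          ((((1 : ℤ) * δ i + (1 + 1) * (rin i - rout i) + ((1 : ℤ) ^ 2 * m' i s - 1 * δ i - (1 + 1) * rin i) % e i) -
            ((1 : ℤ) ^ 2 - 1) * m' i s) -
            ∑ n ∈ range L, (((1 + (n : ℤ)) * δ i + (1 + (n : ℤ) + 1) * (rin i - rout i) +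
              ((1 + (n : ℤ)) ^ 2 * m' i s - (1 + (n : ℤ)) * δ i - (1 + (n : ℤ) + 1) * rin i) % e i) -
                ((1 + (n : ℤ)) ^ 2 - 1) * m' i s)) : ℤ) : ℝ)) / (s * M₁))
      (-1) ((∑ i, c i * ((δ i + 2 * (rin i - rout i) + (e i - 1) : ℤ) : ℝ)) / M₁) :=
  exponentAtMost_neg_one_of_le_const hM fun s _ => towerOrbit_financedMass_le_const he hc L fun i => m' i s

/-- **ABOVE ONSET THE PROFILE IS PINNED BELOW BY `(Σ_i c_i·(δ_i + 2G_i)/M₁)·s⁻¹`**: if from `s₀` on every place is above its financing-collapse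
height at the orbit's depths (`3δ_i + 5G_i + 2(e_i − 1) < 3·m′_i(s)`, `L ≥ 2`), p537683 `towerOrbit_financedMass_bracket` BY NAME gives the lower
m′-free constant. [folklore] -/
theorem towerOrbit_financedMass_mul_inv_le {e δ rin rout : Fin k → ℤ} (he : ∀ i, 0 < e i) (hδ : ∀ i, 0 ≤ δ i)
    (hio : ∀ i, rout i ≤ rin i) {L : ℕ} (hL : 2 ≤ L) {c : Fin k → ℝ} (hc : ∀ i, 0 ≤ c i) {m' : Fin k → ℝ → ℤ} {s₀ : ℝ}
    (hs₀ : 1 ≤ s₀) (hon : ∀ s : ℝ, s₀ ≤ s → ∀ i, 3 * δ i + 5 * (rin i - rout i) + 2 * (e i - 1) < 3 * m' i s) {M₁ : ℝ} (hM : 0 < M₁)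
    (s : ℝ) (hs : s₀ ≤ s) :
    (∑ i, c i * ((δ i + 2 * (rin i - rout i) : ℤ) : ℝ)) / M₁ * s⁻¹ ≤
      (∑ i, c i * ((min ((((1 : ℤ) * δ i + (1 + 1) * (rin i - rout i) + ((1 : ℤ) ^ 2 * m' i s - 1 * δ i - (1 + 1) * rin i) % e i) -
            ((1 : ℤ) ^ 2 - 1) * m' i s))
          ((((1 : ℤ) * δ i + (1 + 1) * (rin i - rout i) + ((1 : ℤ) ^ 2 * m' i s - 1 * δ i - (1 + 1) * rin i) % e i) -
            ((1 : ℤ) ^ 2 - 1) * m' i s) -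
            ∑ n ∈ range L, (((1 + (n : ℤ)) * δ i + (1 + (n : ℤ) + 1) * (rin i - rout i) +
              ((1 + (n : ℤ)) ^ 2 * m' i s - (1 + (n : ℤ)) * δ i - (1 + (n : ℤ) + 1) * rin i) % e i) -
                ((1 + (n : ℤ)) ^ 2 - 1) * m' i s)) : ℤ) : ℝ)) / (s * M₁) := by
  have hs1 : 0 < s := by linarith
  have hlo := (towerOrbit_financedMass_bracket (m' := fun i => m' i s) he hδ hio hL hc (hon s hs)).1
  have heq : (∑ i, c i * ((δ i + 2 * (rin i - rout i) : ℤ) : ℝ)) / M₁ * s⁻¹ =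
      (∑ i, c i * ((δ i + 2 * (rin i - rout i) : ℤ) : ℝ)) / (s * M₁) := by
    ring
  rw [heq]
  exact div_le_div_of_nonneg_right hlo (by positivity)

/-- **«EXPONENT −1 EXACTLY ALONG THE ORBIT» (census O-08, kernel-exact).** Along ANY orbit whose places stay above onset from some `s₀ ≥ 1` on,
with a positive lower constant `Σ_i c_i·(δ_i + 2G_i) > 0`, the financed-mass profile has exponent `−1` (`towerOrbit_financedMass_exponentAtMost`)
and NO exponent `α < −1` with any constant — the tower's direction, `N` and index never enter. [folklore] -/
theorem towerOrbit_financedMass_exponent_exact {e δ rin rout : Fin k → ℤ} (he : ∀ i, 0 < e i) (hδ : ∀ i, 0 ≤ δ i)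
    (hio : ∀ i, rout i ≤ rin i) {L : ℕ} (hL : 2 ≤ L) {c : Fin k → ℝ} (hc : ∀ i, 0 ≤ c i) {m' : Fin k → ℝ → ℤ} {s₀ : ℝ}
    (hs₀ : 1 ≤ s₀) (hon : ∀ s : ℝ, s₀ ≤ s → ∀ i, 3 * δ i + 5 * (rin i - rout i) + 2 * (e i - 1) < 3 * m' i s) {M₁ : ℝ} (hM : 0 < M₁)
    (hpos : 0 < ∑ i, c i * ((δ i + 2 * (rin i - rout i) : ℤ) : ℝ)) {α : ℝ} (hα : α < -1) (C : ℝ) :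
    ¬ ExponentAtMost
      (fun s => (∑ i, c i * ((min ((((1 : ℤ) * δ i + (1 + 1) * (rin i - rout i) + ((1 : ℤ) ^ 2 * m' i s - 1 * δ i - (1 + 1) * rin i) % e i) -
            ((1 : ℤ) ^ 2 - 1) * m' i s))
          ((((1 : ℤ) * δ i + (1 + 1) * (rin i - rout i) + ((1 : ℤ) ^ 2 * m' i s - 1 * δ i - (1 + 1) * rin i) % e i) -
            ((1 : ℤ) ^ 2 - 1) * m' i s) -
            ∑ n ∈ range L, (((1 + (n : ℤ)) * δ i + (1 + (n : ℤ) + 1) * (rin i - rout i) +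
              ((1 + (n : ℤ)) ^ 2 * m' i s - (1 + (n : ℤ)) * δ i - (1 + (n : ℤ) + 1) * rin i) % e i) -
                ((1 + (n : ℤ)) ^ 2 - 1) * m' i s)) : ℤ) : ℝ)) / (s * M₁))
      α C :=
  not_exponentAtMost_of_mul_inv_le (div_pos hpos hM) hs₀
    (fun s hs => towerOrbit_financedMass_mul_inv_le he hδ hio hL hc hs₀ hon hM s hs) hα C

/-! ## §5. Worked orbit X1 (FREY `p = 7`, `l = 107`) in profile words -/

/-- **X1: along ANY floor schedule of the 2-tower, `ExponentAtMost (−1) (9 414 496 / 10 707 060)`.** With the place height read at any floor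
`a(s)` (`m = 210·2^{a(s)}`) and any slice boundary `J(s) ≤ 53`, the EXP-3 fraction against the base requirement `10 707 060·s` is
`≤ 0.8793·s⁻¹` at every `s ≥ 1` (p534933 `row_frey7_l107_onSliceCredit_le_envelope` at the height `2^{a(s)}` BY NAME). [folklore] -/
theorem row_frey7_l107_tower2_exponentAtMost {J : ℝ → ℕ} (hJ : ∀ s, J s ≤ 53) (a : ℝ → ℕ) :
    ExponentAtMost
      (fun s => ((∑ k ∈ range (J s), (((1 + (k : ℤ)) * 1604 + (1 + (k : ℤ) + 1) * (268 - (-4472)) +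
          ((1 + (k : ℤ)) ^ 2 * (210 * 2 ^ (a s)) - (1 + (k : ℤ)) * 1604 - (1 + (k : ℤ) + 1) * 268) % 1605) -
            ((1 + (k : ℤ)) ^ 2 - 1) * (210 * 2 ^ (a s))) : ℤ) : ℝ) / (s * 10707060))
      (-1) (9414496 / 10707060) :=
  exponentAtMost_neg_one_of_le_const (by norm_num) fun s _ => by
    exact_mod_cast row_frey7_l107_onSliceCredit_le_envelope (2 ^ (a s)) (pow_nonneg (by norm_num) _) (hJ s)

/-- X1, the genuine 2-isogeny orbit's two points in currency numbers: the halved point's mass is HALF and the doubled point's mass TWICE the base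
`10 707 060` (`105·S(53) = 5 353 530`, `420·S(53) = 21 414 120`), while the place's cap `C_Π = 9 414 496` does not move: the financing fraction
bound `C_Π/M` reads `1.7586…` (content-free side: `C_Π > M`) at the halved point and `0.4396…` at the doubled one — the ray's `C_Π/(s·M₁)` at
`s = ½, 2`. [folklore] -/
theorem row_frey7_l107_isog2_massRatios :
    (105 : ℤ) * 50986 = 5353530 ∧ (420 : ℤ) * 50986 = 21414120 ∧ (2 : ℤ) * 5353530 = 10707060 ∧ (2 : ℤ) * 10707060 = 21414120 ∧
      (9414496 : ℤ) > 5353530 ∧ (9414496 : ℤ) < 10707060 ∧ 2 * (9414496 : ℤ) < 21414120 := by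
  norm_num

end Summit.ABC.IUTFork.Repair.RH.TowerOrbit
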